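import Summits.AtomisticToContinuum.FouriersLaw.Theorems.OddSectorIrreversibilitySubBallisticWindowAbelGreenKuboConverse

/-!
# `SubBallisticWindow` (stmt-AtomisticToContinuum-14070): the Abel–Green–Kubo form of the crux, part 4 (the pairing identity)

Support file for crux `Summit.AtomisticToContinuum.FouriersLaw.Theses.OddSectorIrreversibility.SubBallisticWindow`
(E2 of route OddSectorIrreversibility). Parts 1–3 proved `SubBallisticWindow ↔ (r ‖u_r‖²_{L²(μ_T)} ≤ C ℓ Z
uniformly)` for the Abel corrector `u_r(x) = ∫_{(0,∞)} e^{-rt} J_B(Φ_t x) dt` of the CLOSED chain. This part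
identifies `r ‖u_r‖²` with the GREEN–KUBO integral:

* `integral_abel_mul_blockCurrent` — Fubini: `⟨u_r, J_B⟩_{μ_T} = ∫_{(0,∞)} e^{-rt} ⟨J_B∘Φ_t, J_B⟩_{μ_T} dt`;
* `mul_integral_abel_sq_eq_pairing` — `r ‖u_r‖²_{L²(μ_T)} = ⟨u_r, J_B⟩_{μ_T}`: integrate the pointwise identity
  `u_r(Φ_1 x)² - u_r(x)² = ∫₀¹ 2 u_r(Φ_s x) (r u_r(Φ_s x) - J_B(Φ_s x)) ds` (`(r - L) u_r = J_B` along the flow)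
  against `μ_T` and use Liouville invariance at each `s` — the `L²` form of the skew-symmetry of the Liouvillian,
  with no differentiation under the integral sign and no regularity of `u_r`;
* `subBallisticWindow_iff_greenKuboBound` — crux vocabulary: E2 `↔ ∃ C ∀ N ∀ [k₁,k₂) ∀ r ∈ (0,1]:
  ∫_{(0,∞)} e^{-rt} (∫ (P⁰_t J_B)(x) J_B(x) dμ_T(x)) dt ≤ C (k₂ - k₁) Z` — the Abel-regularised finite-volume
  Green–Kubo integral of the block current autocorrelation is bounded uniformly in volume, block and cutoff
  (bounded block conductivity; open in print for every deterministic anharmonic lattice, BonettoLebowitzReyBellet2000 §6.3).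

Nothing here closes the item. Lead c8 of line `Sketch`, 2026-08-17.
-/

noncomputable section

namespace Summit.AtomisticToContinuum.FouriersLaw.Theorems.SubBallisticWindow.AbelGreenKubo

open MeasureTheory Filter Topology Set
open scoped NNReal ENNReal
open Literature.MathematicalPhysics.KineticTheory.HeatConduction
open Summit.AtomisticToContinuum.FouriersLaw.Theorems.ClosedConeSensitivity.Negative.ZeroFrictionDictionary
open Summit.AtomisticToContinuum.FouriersLaw.Theorems.OddSectorWitness

variable {ω₂ lam β : ℝ} (hω : 0 < ω₂) (hl : 0 ≤ lam) (hβ : 0 ≤ β)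
include hω hl hβ

section Pairing

variable (γ : ℝ) (N k₁ k₂ : ℕ)

/-! ## §5.1 Fubini: the pairing `⟨u_r, J_B⟩` is the Abel-regularised Green–Kubo integral -/

/-- The static block current is dominated by the energy bound `K(x)` (time `0` of `abs_blockCurrent_detFlow_le`).
[folklore] -/
theorem abs_blockCurrent_le_energy (x : PhaseSpace N) :
    |blockCurrent ω₂ lam β γ N k₁ k₂ x| ≤
      N * (N * ((3 + β) / 2 * (1 + (pinnedChain ω₂ lam β γ).hamiltonian N x) ^ 2)) := by
  have h := abs_blockCurrent_detFlow_le hω hl hβ N γ k₁ k₂ 0 x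
  rwa [detFlow_of_nonpos N le_rfl] at h

/-- `K² ∈ L¹(μ_T)` for the energy bound `K(x) = N² (3+β)/2 (1+H(x))²`. [folklore] -/
theorem integrable_energyBound_sq {T : ℝ} (hT : 0 < T) :
    Integrable (fun x : PhaseSpace N =>
      (N * (N * ((3 + β) / 2 * (1 + (pinnedChain ω₂ lam β γ).hamiltonian N x) ^ 2))) ^ 2)
      (gibbsWeight ω₂ lam β γ N T) := by
  have h4 := (integrable_one_add_hamiltonian_pow hω hl hβ γ N hT 4).const_mul ((N * (N * ((3 + β) / 2))) ^ 2)
  refine h4.congr (Eventually.of_forall fun x => ?_)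
  simp only
  ring

/-- **Fubini for the pairing.** For `r > 0`, `T > 0`:
`∫ u_r(x) J_B(x) dμ_T = ∫_{(0,∞)} e^{-rt} (∫ J_B(Φ_t x) J_B(x) dμ_T) dt`, and the autocorrelation
`t ↦ e^{-rt} ∫ J_B(Φ_t x) J_B(x) dμ_T` is integrable on `(0,∞)`. [folklore] -/
theorem integral_abel_mul_blockCurrent {T : ℝ} (hT : 0 < T) {r : ℝ} (hr : 0 < r) :
    (∫ x, (∫ t in Ioi (0:ℝ), Real.exp (-r * t) * blockCurrent ω₂ lam β γ N k₁ k₂ (detFlow ω₂ lam β N t x)) *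
        blockCurrent ω₂ lam β γ N k₁ k₂ x ∂(gibbsWeight ω₂ lam β γ N T) =
      ∫ t in Ioi (0:ℝ), Real.exp (-r * t) *
        ∫ x, blockCurrent ω₂ lam β γ N k₁ k₂ (detFlow ω₂ lam β N t x) * blockCurrent ω₂ lam β γ N k₁ k₂ x
          ∂(gibbsWeight ω₂ lam β γ N T)) ∧
    IntegrableOn (fun t : ℝ => Real.exp (-r * t) *
        ∫ x, blockCurrent ω₂ lam β γ N k₁ k₂ (detFlow ω₂ lam β N t x) * blockCurrent ω₂ lam β γ N k₁ k₂ x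
          ∂(gibbsWeight ω₂ lam β γ N T)) (Ioi 0) := by
  haveI := isFiniteMeasure_gibbsWeight hω hl hβ γ N hT
  set μ := gibbsWeight ω₂ lam β γ N T with hμ
  set K : PhaseSpace N → ℝ := fun x =>
    (N * (N * ((3 + β) / 2 * (1 + (pinnedChain ω₂ lam β γ).hamiltonian N x) ^ 2)) : ℝ) with hK
  set J : PhaseSpace N → ℝ := blockCurrent ω₂ lam β γ N k₁ k₂ with hJ
  set G : ℝ × PhaseSpace N → ℝ := fun p =>
    Real.exp (-r * p.1) * (J (detFlow ω₂ lam β N p.1 p.2) * J p.2) with hG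
  -- measurability (the transported current is elaborated forward, cf. `measurable_abel`)
  have hJt : Measurable fun p : ℝ × PhaseSpace N => J (detFlow ω₂ lam β N p.1 p.2) :=
    measurable_blockCurrent_detFlow hω hl hβ N γ k₁ k₂
  have hJ0 : Measurable fun p : ℝ × PhaseSpace N => J p.2 :=
    (continuous_blockCurrent N γ k₁ k₂).measurable.comp measurable_snd
  have hE : Measurable fun p : ℝ × PhaseSpace N => Real.exp (-r * p.1) :=
    (Real.continuous_exp.measurable).comp (measurable_fst.const_mul (-r))
  have hGm : Measurable G := hE.mul (hJt.mul hJ0)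
  -- domination by `e^{-rt} K(x)²`
  have hdom : Integrable (fun p : ℝ × PhaseSpace N => Real.exp (-r * p.1) * (K p.2) ^ 2)
      ((volume.restrict (Ioi (0:ℝ))).prod μ) :=
    (exp_neg_integrableOn_Ioi 0 hr).mul_prod (integrable_energyBound_sq hω hl hβ γ N hT)
  have hbound : ∀ p : ℝ × PhaseSpace N, ‖G p‖ ≤ Real.exp (-r * p.1) * (K p.2) ^ 2 := fun p => by
    simp only [hG]
    rw [norm_mul, Real.norm_eq_abs, Real.norm_eq_abs, abs_of_pos (Real.exp_pos _), abs_mul]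
    refine mul_le_mul_of_nonneg_left ?_ (Real.exp_pos _).le
    have h1 : |J (detFlow ω₂ lam β N p.1 p.2)| ≤ K p.2 := abs_blockCurrent_detFlow_le hω hl hβ N γ k₁ k₂ p.1 p.2
    have h2 : |J p.2| ≤ K p.2 := abs_blockCurrent_le_energy hω hl hβ γ N k₁ k₂ p.2
    have hK0 : 0 ≤ K p.2 := le_trans (abs_nonneg _) h2
    calc |J (detFlow ω₂ lam β N p.1 p.2)| * |J p.2| ≤ K p.2 * K p.2 :=
          mul_le_mul h1 h2 (abs_nonneg _) hK0
      _ = (K p.2) ^ 2 := by ring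
  have hInt : Integrable G ((volume.restrict (Ioi (0:ℝ))).prod μ) :=
    hdom.mono' hGm.aestronglyMeasurable (Eventually.of_forall hbound)
  refine ⟨?_, ?_⟩
  · -- pull `J_B(x)` inside, then swap
    have hpt : ∀ x, (∫ t in Ioi (0:ℝ), Real.exp (-r * t) * J (detFlow ω₂ lam β N t x)) * J x =
        ∫ t in Ioi (0:ℝ), G (t, x) := fun x => by
      rw [← integral_mul_const]
      refine integral_congr_ae (ae_of_all _ fun t => ?_)
      simp only [hG]
      ring
    have hI' : Integrable (Function.uncurry fun (x : PhaseSpace N) (t : ℝ) => G (t, x))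
        (μ.prod (volume.restrict (Ioi (0:ℝ)))) := hInt.swap
    rw [integral_congr_ae (Eventually.of_forall hpt), integral_integral_swap hI']
    refine integral_congr_ae (ae_of_all _ fun t => ?_)
    simp only [hG]
    rw [integral_const_mul]
  · have h : IntegrableOn (fun t : ℝ => ∫ x, G (t, x) ∂μ) (Ioi 0) := hInt.integral_prod_left
    refine h.congr_fun (fun t _ => ?_) measurableSet_Ioi
    simp only [hG]
    rw [integral_const_mul]

/-! ## §5.2 `r ‖u_r‖² = ⟨u_r, J_B⟩`: skew-symmetry of the Liouvillian, `L²` form -/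

/-- **The pairing identity.** For `r > 0`, `T > 0`: `r ∫ u_r² dμ_T = ∫ u_r J_B dμ_T`. Proof: for each `x` the
`C¹` function `s ↦ u_r(Φ_s x)²` has derivative `2 u_r(Φ_s x) (r u_r(Φ_s x) - J_B(Φ_s x))` (`(r - L)u_r = J_B` along the
flow, part 1), so `u_r(Φ_1 x)² - u_r(x)² = ∫₀¹ 2 u_r(Φ_s x)(r u_r(Φ_s x) - J_B(Φ_s x)) ds`; integrating against `μ_T`,
the left side vanishes and the right side is `2 r ‖u_r‖² - 2 ⟨u_r, J_B⟩` (Fubini and Liouville invariance at each `s`).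
[folklore] -/
theorem mul_integral_abel_sq_eq_pairing {T : ℝ} (hT : 0 < T) {r : ℝ} (hr : 0 < r) :
    r * ∫ x, (∫ t in Ioi (0:ℝ), Real.exp (-r * t) * blockCurrent ω₂ lam β γ N k₁ k₂ (detFlow ω₂ lam β N t x)) ^ 2
        ∂(gibbsWeight ω₂ lam β γ N T) =
      ∫ x, (∫ t in Ioi (0:ℝ), Real.exp (-r * t) * blockCurrent ω₂ lam β γ N k₁ k₂ (detFlow ω₂ lam β N t x)) *
        blockCurrent ω₂ lam β γ N k₁ k₂ x ∂(gibbsWeight ω₂ lam β γ N T) := by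
  haveI := isFiniteMeasure_gibbsWeight hω hl hβ γ N hT
  set μ := gibbsWeight ω₂ lam β γ N T with hμ
  set K : PhaseSpace N → ℝ := fun x =>
    (N * (N * ((3 + β) / 2 * (1 + (pinnedChain ω₂ lam β γ).hamiltonian N x) ^ 2)) : ℝ) with hK
  set J : PhaseSpace N → ℝ := blockCurrent ω₂ lam β γ N k₁ k₂ with hJ
  set u : PhaseSpace N → ℝ := fun x => ∫ t in Ioi (0:ℝ), Real.exp (-r * t) * J (detFlow ω₂ lam β N t x) with hu
  have hum : Measurable u := measurable_abel hω hl hβ γ N k₁ k₂ r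
  have hu2 : Integrable (fun x => (u x) ^ 2) μ := integrable_sq_abel hω hl hβ γ N k₁ k₂ hT hr
  -- energy bounds, uniform along the flow
  have hKflow : ∀ (s : ℝ) (x : PhaseSpace N), K (detFlow ω₂ lam β N s x) = K x := fun s x => by
    simp only [hK, hamiltonian_detFlow_all hω hl hβ N γ s x]
  have huK : ∀ (s : ℝ) (x : PhaseSpace N), |u (detFlow ω₂ lam β N s x)| ≤ K x / r := fun s x => by
    have h := abs_abel_le hω hl hβ γ N k₁ k₂ hr (detFlow ω₂ lam β N s x)
    rw [hamiltonian_detFlow_all hω hl hβ N γ s x] at h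
    exact h
  have hJK : ∀ (s : ℝ) (x : PhaseSpace N), |J (detFlow ω₂ lam β N s x)| ≤ K x := fun s x =>
    abs_blockCurrent_detFlow_le hω hl hβ N γ k₁ k₂ s x
  have hK0 : ∀ x : PhaseSpace N, 0 ≤ K x := fun x => le_trans (abs_nonneg _) (hJK 0 x)
  -- the integrand of the time integral and its domination by `4 K² / r`
  set F : ℝ × PhaseSpace N → ℝ := fun p =>
    2 * u (detFlow ω₂ lam β N p.1 p.2) * (r * u (detFlow ω₂ lam β N p.1 p.2) - J (detFlow ω₂ lam β N p.1 p.2))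
    with hF
  have hut : Measurable fun p : ℝ × PhaseSpace N => u (detFlow ω₂ lam β N p.1 p.2) :=
    hum.comp (measurable_detFlow_uncurry hω hl hβ N)
  have hJt : Measurable fun p : ℝ × PhaseSpace N => J (detFlow ω₂ lam β N p.1 p.2) :=
    measurable_blockCurrent_detFlow hω hl hβ N γ k₁ k₂
  have hFm : Measurable F := (hut.const_mul 2).mul ((hut.const_mul r).sub hJt)
  have hbound : ∀ p : ℝ × PhaseSpace N, ‖F p‖ ≤ 1 * (4 / r * (K p.2) ^ 2) := fun p => by
    simp only [hF]
    rw [one_mul, Real.norm_eq_abs, abs_mul, abs_mul, abs_two]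
    have h1 := huK p.1 p.2
    have h2 := hJK p.1 p.2
    have h3 : |r * u (detFlow ω₂ lam β N p.1 p.2) - J (detFlow ω₂ lam β N p.1 p.2)| ≤ 2 * K p.2 := by
      refine (abs_sub _ _).trans ?_
      rw [abs_mul, abs_of_pos hr]
      have : r * |u (detFlow ω₂ lam β N p.1 p.2)| ≤ K p.2 := by
        have := mul_le_mul_of_nonneg_left h1 hr.le
        rwa [mul_div_cancel₀ _ hr.ne'] at this
      linarith
    have h4 : |u (detFlow ω₂ lam β N p.1 p.2)| * |r * u (detFlow ω₂ lam β N p.1 p.2) - J (detFlow ω₂ lam β N p.1 p.2)|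
        ≤ (K p.2 / r) * (2 * K p.2) := mul_le_mul h1 h3 (abs_nonneg _) (div_nonneg (hK0 _) hr.le)
    calc 2 * |u (detFlow ω₂ lam β N p.1 p.2)| * |r * u (detFlow ω₂ lam β N p.1 p.2) - J (detFlow ω₂ lam β N p.1 p.2)|
        ≤ 2 * ((K p.2 / r) * (2 * K p.2)) := by rw [mul_assoc]; exact mul_le_mul_of_nonneg_left h4 two_pos.le
      _ = 4 / r * (K p.2) ^ 2 := by ring
  have hdom : Integrable (fun p : ℝ × PhaseSpace N => (1:ℝ) * (4 / r * (K p.2) ^ 2))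
      ((volume.restrict (Ioc (0:ℝ) 1)).prod μ) :=
    (integrable_const (1:ℝ)).mul_prod ((integrable_energyBound_sq hω hl hβ γ N hT).const_mul (4 / r))
  have hInt : Integrable F ((volume.restrict (Ioc (0:ℝ) 1)).prod μ) :=
    hdom.mono' hFm.aestronglyMeasurable (Eventually.of_forall hbound)
  -- pointwise FTC on `[0, 1]`
  have hpt : ∀ x, (u (detFlow ω₂ lam β N 1 x)) ^ 2 - (u x) ^ 2 = ∫ s in Ioc (0:ℝ) 1, F (s, x) := fun x => by
    have hUc : Continuous fun s : ℝ => u (detFlow ω₂ lam β N s x) :=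
      continuous_abel_comp_detFlow hω hl hβ γ N k₁ k₂ hr x
    have hjc : Continuous fun s : ℝ => J (detFlow ω₂ lam β N s x) :=
      (continuous_blockCurrent N γ k₁ k₂).comp (continuous_detFlow_time hω hl hβ N x)
    have hFc : Continuous fun s : ℝ => F (s, x) := by
      simp only [hF]
      exact ((hUc.const_mul 2)).mul ((hUc.const_mul r).sub hjc)
    have hderiv : ∀ s ∈ Ioo (0:ℝ) 1, HasDerivWithinAt (fun s : ℝ => (u (detFlow ω₂ lam β N s x)) ^ 2)
        (F (s, x)) (Ioi s) s := fun s hs => by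
      have hd := hasDerivAt_abel_comp_detFlow hω hl hβ γ N k₁ k₂ hr x hs.1
      have hd2 := hd.pow 2
      refine (hd2.hasDerivWithinAt).congr_deriv ?_
      simp only [hF, hu, hJ]
      ring
    have hcont : ContinuousOn (fun s : ℝ => (u (detFlow ω₂ lam β N s x)) ^ 2) (Icc 0 1) :=
      (hUc.pow 2).continuousOn
    have hftc := intervalIntegral.integral_eq_sub_of_hasDeriv_right_of_le zero_le_one hcont hderiv
      (hFc.intervalIntegrable 0 1)
    rw [intervalIntegral.integral_of_le zero_le_one, detFlow_of_nonpos N le_rfl] at hftc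
    exact hftc.symm
  -- integrate against `μ_T`: the left side vanishes by invariance
  have hL : ∫ x, ((u (detFlow ω₂ lam β N 1 x)) ^ 2 - (u x) ^ 2) ∂μ = 0 := by
    have h1 : Integrable (fun x => (u (detFlow ω₂ lam β N 1 x)) ^ 2) μ :=
      CoboundaryCeiling.integrable_comp_detFlow_gibbsWeight hω hl hβ γ N T zero_le_one (g := fun x => (u x) ^ 2) hu2
    rw [integral_sub h1 hu2,
      CoboundaryCeiling.integral_comp_detFlow_gibbsWeight hω hl hβ γ N T zero_le_one (g := fun x => (u x) ^ 2)
        hu2.aestronglyMeasurable, sub_self]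
  -- the right side: Fubini and invariance at each `s`
  have huJ : Integrable (fun x => u x * J x) μ := by
    refine Integrable.mono' ((integrable_energyBound_sq hω hl hβ γ N hT).const_mul (1 / r))
      (hum.mul (continuous_blockCurrent N γ k₁ k₂).measurable).aestronglyMeasurable
      (Eventually.of_forall fun x => ?_)
    rw [Real.norm_eq_abs, abs_mul]
    have h1 := huK 0 x
    have h2 := hJK 0 x
    rw [detFlow_of_nonpos N le_rfl] at h1 h2
    calc |u x| * |J x| ≤ (K x / r) * K x := mul_le_mul h1 h2 (abs_nonneg _) (div_nonneg (hK0 x) hr.le)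
      _ = 1 / r * (K x) ^ 2 := by ring
  have hslice : ∀ s ∈ Ioc (0:ℝ) 1, ∫ x, F (s, x) ∂μ = 2 * r * ∫ x, (u x) ^ 2 ∂μ - 2 * ∫ x, u x * J x ∂μ :=
    fun s hs => by
    have hs0 : 0 ≤ s := hs.1.le
    have hA : ∫ x, (u (detFlow ω₂ lam β N s x)) ^ 2 ∂μ = ∫ x, (u x) ^ 2 ∂μ :=
      CoboundaryCeiling.integral_comp_detFlow_gibbsWeight hω hl hβ γ N T hs0 (g := fun x => (u x) ^ 2)
        hu2.aestronglyMeasurable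
    have hB : ∫ x, u (detFlow ω₂ lam β N s x) * J (detFlow ω₂ lam β N s x) ∂μ = ∫ x, u x * J x ∂μ :=
      CoboundaryCeiling.integral_comp_detFlow_gibbsWeight hω hl hβ γ N T hs0 (g := fun x => u x * J x)
        huJ.aestronglyMeasurable
    have hA' : Integrable (fun x => (u (detFlow ω₂ lam β N s x)) ^ 2) μ :=
      CoboundaryCeiling.integrable_comp_detFlow_gibbsWeight hω hl hβ γ N T hs0 (g := fun x => (u x) ^ 2) hu2
    have hB' : Integrable (fun x => u (detFlow ω₂ lam β N s x) * J (detFlow ω₂ lam β N s x)) μ :=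
      CoboundaryCeiling.integrable_comp_detFlow_gibbsWeight hω hl hβ γ N T hs0 (g := fun x => u x * J x) huJ
    have hpt2 : ∀ x, F (s, x) = 2 * r * (u (detFlow ω₂ lam β N s x)) ^ 2 -
        2 * (u (detFlow ω₂ lam β N s x) * J (detFlow ω₂ lam β N s x)) := fun x => by
      simp only [hF]
      ring
    rw [integral_congr_ae (Eventually.of_forall hpt2), integral_sub (hA'.const_mul _) (hB'.const_mul _),
      integral_const_mul, integral_const_mul, hA, hB]
  have hInt' : Integrable (Function.uncurry fun (s : ℝ) (x : PhaseSpace N) => F (s, x))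
      ((volume.restrict (Ioc (0:ℝ) 1)).prod μ) := hInt
  have hR : ∫ x, (∫ s in Ioc (0:ℝ) 1, F (s, x)) ∂μ = 2 * r * ∫ x, (u x) ^ 2 ∂μ - 2 * ∫ x, u x * J x ∂μ := by
    rw [← integral_integral_swap hInt', setIntegral_congr_fun measurableSet_Ioc hslice, setIntegral_const,
      Real.volume_real_Ioc_of_le zero_le_one, sub_zero, one_smul]
  have hkey : 2 * r * ∫ x, (u x) ^ 2 ∂μ - 2 * ∫ x, u x * J x ∂μ = 0 := by
    rw [← hR, ← integral_congr_ae (Eventually.of_forall hpt), hL]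
  have hgoal : r * ∫ x, (u x) ^ 2 ∂μ = ∫ x, u x * J x ∂μ := by linarith
  simp only [hu, hJ, hμ] at hgoal
  exact hgoal

/-! ## §5.3 Crux vocabulary: E2 ⟺ the N-uniform Abel–Green–Kubo bound -/

/-- The Abel-regularised Green–Kubo integral of the block current IS `r ‖u_r‖²` (kernel vocabulary; Dirac
dictionary, Fubini `integral_abel_mul_blockCurrent`, pairing identity `mul_integral_abel_sq_eq_pairing`). [folklore] -/
theorem greenKubo_eq_mul_integral_abel_sq {T : ℝ} (hT : 0 < T) {r : ℝ} (hr : 0 < r) :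
    ∫ t in Ioi (0:ℝ), Real.exp (-r * t) * (∫ x, (∫ y, blockCurrent ω₂ lam β γ N k₁ k₂ y
        ∂((pinnedChain ω₂ lam β 0).transitionKernel N T T t.toNNReal x)) * blockCurrent ω₂ lam β γ N k₁ k₂ x
          ∂(gibbsWeight ω₂ lam β γ N T)) =
      r * ∫ x, (∫ t in Ioi (0:ℝ), Real.exp (-r * t) * (∫ y, blockCurrent ω₂ lam β γ N k₁ k₂ y
        ∂((pinnedChain ω₂ lam β 0).transitionKernel N T T t.toNNReal x))) ^ 2 ∂(gibbsWeight ω₂ lam β γ N T) := by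
  have h1 : ∫ t in Ioi (0:ℝ), Real.exp (-r * t) * (∫ x, (∫ y, blockCurrent ω₂ lam β γ N k₁ k₂ y
        ∂((pinnedChain ω₂ lam β 0).transitionKernel N T T t.toNNReal x)) * blockCurrent ω₂ lam β γ N k₁ k₂ x
          ∂(gibbsWeight ω₂ lam β γ N T)) =
      ∫ t in Ioi (0:ℝ), Real.exp (-r * t) * (∫ x, blockCurrent ω₂ lam β γ N k₁ k₂ (detFlow ω₂ lam β N t x) *
        blockCurrent ω₂ lam β γ N k₁ k₂ x ∂(gibbsWeight ω₂ lam β γ N T)) := by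
    refine setIntegral_congr_fun measurableSet_Ioi fun t ht => ?_
    congr 1
    refine integral_congr_ae (ae_of_all _ fun x => ?_)
    dsimp only
    rw [integral_transitionKernel_zero_friction hω hl hβ, Real.coe_toNNReal _ (le_of_lt ht)]
  have h2 := (integral_abel_mul_blockCurrent hω hl hβ γ N k₁ k₂ hT hr).1
  have h3 := mul_integral_abel_sq_eq_pairing hω hl hβ γ N k₁ k₂ hT hr
  have h4 : ∫ x, (∫ t in Ioi (0:ℝ), Real.exp (-r * t) * (∫ y, blockCurrent ω₂ lam β γ N k₁ k₂ y
        ∂((pinnedChain ω₂ lam β 0).transitionKernel N T T t.toNNReal x))) ^ 2 ∂(gibbsWeight ω₂ lam β γ N T) =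
      ∫ x, (∫ t in Ioi (0:ℝ), Real.exp (-r * t) *
        blockCurrent ω₂ lam β γ N k₁ k₂ (detFlow ω₂ lam β N t x)) ^ 2 ∂(gibbsWeight ω₂ lam β γ N T) :=
    integral_congr_ae (Eventually.of_forall fun x => by
      simp only [integral_abel_kernel_eq hω hl hβ γ N k₁ k₂ T r x])
  rw [h1, ← h2, ← h3, h4]

end Pairing

section Crux

open Summit.AtomisticToContinuum.FouriersLaw.Theses.OddSectorIrreversibility

omit hω hl hβ in
/-- **`SubBallisticWindow` ⟺ the N-uniform Abel–Green–Kubo bound** (registered sub-goal, crux vocabulary). The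
crux E2 is EQUIVALENT to: for all parameters `> 0` and `T > 0` there is `C` such that for every `N`, every block
`[k₁,k₂)` (`k₂ + 1 ≤ N`) and every cutoff rate `r ∈ (0,1]`,
`∫_{(0,∞)} e^{-rt} (∫ (P⁰_t J_B)(x) · J_B(x) dμ_T(x)) dt ≤ C (k₂ - k₁) Z`
— the Abel-regularised finite-volume GREEN–KUBO integral of the block current autocorrelation of the CLOSED
(deterministic) pinned anharmonic chain is bounded, uniformly in volume, block and cutoff (bounded block
conductivity; `subBallisticWindow_iff_abelBound` and `greenKubo_eq_mul_integral_abel_sq`). In print this is open for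
every deterministic anharmonic lattice (BonettoLebowitzReyBellet2000 §6.3). [folklore] -/
theorem subBallisticWindow_iff_greenKuboBound : SubBallisticWindow ↔ (∀ ω₂ lam β γ : ℝ, 0 < ω₂ → 0 < lam → 0 < β → 0 < γ → ∀ T : ℝ, 0 < T → ∃ C : ℝ, ∀ (N k₁ k₂ : ℕ), k₁ ≤ k₂ → k₂ + 1 ≤ N → ∀ r : ℝ, 0 < r → r ≤ 1 → let P := pinnedChain ω₂ lam β γ; let P₀ := pinnedChain ω₂ lam β 0; let μT : Measure (PhaseSpace N) := volume.withDensity (fun x : PhaseSpace N => ENNReal.ofReal (Real.exp (-(P.hamiltonian N x) / T))); let JB : PhaseSpace N → ℝ := fun z => ∑ i : Fin N, (if k₁ ≤ i.val ∧ i.val < k₂ then P.bondCurrent N i z else 0); ∫ t in Set.Ioi (0 : ℝ), Real.exp (-r * t) * (∫ x, (∫ y, JB y ∂(P₀.transitionKernel N T T t.toNNReal x)) * JB x ∂μT) ≤ C * ((k₂ : ℝ) - k₁) * ∫ x, Real.exp (-(P.hamiltonian N x) / T) ∂volume) := by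
  rw [subBallisticWindow_iff_abelBound]
  constructor
  · intro h ω₂ lam β γ hω hl hβ hγ T hT
    obtain ⟨C, hC⟩ := h ω₂ lam β γ hω hl hβ hγ T hT
    refine ⟨C, fun N k₁ k₂ hk hkN r hr hr1 => ?_⟩
    have h1 := hC N k₁ k₂ hk hkN r hr hr1
    simp only at h1 ⊢
    rw [show (volume.withDensity fun x : PhaseSpace N =>
        ENNReal.ofReal (Real.exp (-((pinnedChain ω₂ lam β γ).hamiltonian N x) / T))) =
        gibbsWeight ω₂ lam β γ N T from rfl] at h1 ⊢
    have heq := greenKubo_eq_mul_integral_abel_sq hω hl.le hβ.le γ N k₁ k₂ hT hr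
    simp only [blockCurrent] at heq
    rw [heq]
    exact h1
  · intro h ω₂ lam β γ hω hl hβ hγ T hT
    obtain ⟨C, hC⟩ := h ω₂ lam β γ hω hl hβ hγ T hT
    refine ⟨C, fun N k₁ k₂ hk hkN r hr hr1 => ?_⟩
    have h1 := hC N k₁ k₂ hk hkN r hr hr1
    simp only at h1 ⊢
    rw [show (volume.withDensity fun x : PhaseSpace N =>
        ENNReal.ofReal (Real.exp (-((pinnedChain ω₂ lam β γ).hamiltonian N x) / T))) =
        gibbsWeight ω₂ lam β γ N T from rfl] at h1 ⊢
    have heq := greenKubo_eq_mul_integral_abel_sq hω hl.le hβ.le γ N k₁ k₂ hT hr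
    simp only [blockCurrent] at heq
    rw [← heq]
    exact h1

end Crux

end Summit.AtomisticToContinuum.FouriersLaw.Theorems.SubBallisticWindow.AbelGreenKubo

end
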